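import Literature.AlgebraicGeometry.HodgeTheory.WeilClassesFieldSubringDecomposable
import Literature.AlgebraicGeometry.HodgeTheory.WeilClassesFieldDecomposableOfSymmetric
import HarnessLib

/-!
# Moonen–Zarhin's Criterion (2), TYPE 1 WITH `m = 1` FROM End-LEVEL DATA: `φ ∈ ℤ[ψ]` with `ψ` a Rosati-symmetric real
# multiplication is itself Rosati-symmetric on `H¹`, so `W_{ℚ(φ)}` is decomposable, hence algebraic
# (Moonen–Zarhin 1998 §1, Type 1, `B = E`)

Layer `Literature/AlgebraicGeometry/HodgeTheory`; THEOREMS ONLY — no definition, no named fact, no `sorry` (D-0026, net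
debt 0).  Completes the seat's «rows from End-level data» (`WeilClassesFieldSubringMatricesDecomposable`,
`WeilClassesFieldSubringDecomposable`) with the type-1, `m = 1` case, routed through the tree's symmetric case
`WeilClassesFieldDecomposableOfSymmetric`.

## The print

B. J. J. Moonen, Yu. G. Zarhin, *Weil classes on abelian varieties*, J. reine angew. Math. 496 (1998) 83–92 =
arXiv:alg-geom/9612017 [MoonenZarhin1998WeilClasses] (held text `paper:arxiv-alg-geom_9612017`), §1 Table 1 (chunk
p0002 L60–L84): Type 1, `E₀ = E = End⁰(Y)` totally real, `B = M_m(E)`, here `m = 1`: `B = E`; Criterion (2) and its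
proof (chunk p0003 L46–L90): `F ⊆ B` ⟹ `W_F` decomposable.

## What is proved (on `H¹(A(ℂ); ℂ)`)

* **`polarizationPairingOne_symm_of_mem_adjoin_singleton`** — `ℂ⟨T⟩ ∋ g`, `T` `Q_h`-symmetric ⟹ `g` `Q_h`-symmetric.
* `pullbackOne_mem_adjoin_singleton_of_mem_closure` — `φ ∈ ℤ[ψ] ⟹ φ^* ∈ ℂ⟨ψ^*⟩`;
  **`polarizationPairingOne_pullbackOne_symm_of_mem_closure_singleton`** — then `φ^*` is `Q_h`-symmetric.
* **`weilClassesField_le_divisorClassesSpan_of_mem_closure_singleton_of_symm`**,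
  **`weilClassesField_le_algebraicClasses_of_mem_closure_singleton_of_symm`** — `W_F ⊗ ℂ ≤ 𝒟ᵐ ⊗ ℂ ≤ algebraic` for
  `F = ℚ(φ)`, `φ ∈ ℤ[ψ]`.

Scope (honest column).  Integral data (`φ ∈ ℤ[ψ]`; `ℚ(φ) = ℚ(Nφ)`); `0 < dim A` as in the symmetric case; any `A`.

## References

* [MoonenZarhin1998WeilClasses] B. J. J. Moonen, Yu. G. Zarhin, Weil classes on abelian varieties, J. reine angew.
  Math. 496 (1998) 83–92; arXiv:alg-geom/9612017: §1 Table 1 (chunk p0002 L60–L84), Criterion (2) and its proof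
  (chunk p0003 L46–L90).
* [Milne1999LefschetzClasses] J. S. Milne, Lefschetz classes on abelian varieties, Duke Math. J. 96 (1999), Thm. 3.2,
  Cor. 4.5.
* [LangeBirkenhake1992] H. Lange, Ch. Birkenhake, Complex Abelian Varieties (1992), §1.1, §5.1, §5.3.
* [VoisinHodgeI2002] C. Voisin, Hodge Theory and Complex Algebraic Geometry I (CUP 2002), Thm. 11.30.

## Provenance

Lane `lit-hodgefound` (Track 2, Layer A), prover seat `lit-hodgefound-p21` (generation 21), row g21-#11.
-/

noncomputable section

open CategoryTheory CategoryTheory.Limits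
open Literature.AlgebraicTopology.SingularHomology
open Literature.AlgebraicGeometry.Motives
open Literature.AlgebraicGeometry.VanGeemen1994 (hodgeClassSpan pullbackOne)
open Literature.AlgebraicGeometry.Milne1999
open Literature.Geometry.Kaehler (lefschetzPow)
open Literature.Barriers.HodgeConjecture (divisorClassesSpan)
open Literature.LinearAlgebra
open Polynomial

namespace Literature.AlgebraicGeometry.HodgeTheory

section TypeOneSimple

variable {A : AbelianVariety ℂ} {h : complexBetti A.X 2} {ψ φ : A ⟶ A} {P : Polynomial ℤ} {e m : ℕ}

/-- A polynomial in a `B`-self-adjoint operator is `B`-self-adjoint, for any bilinear map `B`. [folklore] -/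
private theorem pairing_aeval_symm' {M W : Type*} [AddCommGroup M] [Module ℂ M] [AddCommGroup W] [Module ℂ W]
    (B : M →ₗ[ℂ] M →ₗ[ℂ] W) (T : Module.End ℂ M) (hT : ∀ v w, B (T v) w = B v (T w)) (q : ℂ[X]) (v w : M) :
    B (aeval T q v) w = B v (aeval T q w) := by
  induction q using Polynomial.induction_on' generalizing v w with
  | add p q hp hq => rw [map_add, LinearMap.add_apply, LinearMap.add_apply, map_add, LinearMap.add_apply, map_add, hp, hq]
  | monomial k c =>
    rw [aeval_monomial, Module.End.mul_apply, Module.End.mul_apply, Module.algebraMap_end_apply,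
      Module.algebraMap_end_apply, map_smul, LinearMap.smul_apply, map_smul]
    congr 1
    induction k generalizing v w with
    | zero => rw [pow_zero, Module.End.one_apply, Module.End.one_apply]
    | succ k ih =>
      conv_lhs => rw [pow_succ', Module.End.mul_apply]
      rw [hT, ih, ← Module.End.mul_apply, ← pow_succ]

/-- **Polynomials in a Rosati-symmetric operator are Rosati-symmetric**: `ℂ⟨T⟩ = {q(T)}`
(`Algebra.adjoin_singleton_eq_range_aeval`) and `Q_h(q(T) v, w) = Q_h(v, q(T) w)` — the commutative subalgebra
`E ⊗ ℂ = ℂ[ψ^*] ⊆ S_λ ⊗ ℂ` of a real multiplication. [cite: MoonenZarhin1998WeilClasses, §1 Table 1, Type 1 («S_λ ⊗ ℂ ⊇ E», m = 1: B = E; chunk p0002 L60–L84)] [cite: LangeBirkenhake1992, §5.1 and §5.3] -/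
theorem polarizationPairingOne_symm_of_mem_adjoin_singleton {T g : Module.End ℂ (complexBetti A.X 1)}
    (hT : ∀ v w : complexBetti A.X 1, polarizationPairingOne A.X h (A.dim - 1) (T v) w =
      polarizationPairingOne A.X h (A.dim - 1) v (T w))
    (hg : g ∈ Algebra.adjoin ℂ ({T} : Set (Module.End ℂ (complexBetti A.X 1)))) (v w : complexBetti A.X 1) :
    polarizationPairingOne A.X h (A.dim - 1) (g v) w = polarizationPairingOne A.X h (A.dim - 1) v (g w) := by
  rw [Algebra.adjoin_singleton_eq_range_aeval] at hg
  obtain ⟨q, rfl⟩ := hg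
  exact pairing_aeval_symm' _ T hT q v w

/-- `φ ∈ ℤ[ψ] ⟹ φ^* ∈ ℂ⟨ψ^*⟩` (`pullbackOne_mem_adjoin_of_mem_closure` at `Γ = {ψ}`). [cite: LangeBirkenhake1992, §1.1] -/
theorem pullbackOne_mem_adjoin_singleton_of_mem_closure (hφ : End.of φ ∈ Subring.closure {End.of ψ}) :
    pullbackOne A φ ∈ Algebra.adjoin ℂ ({pullbackOne A ψ} : Set (Module.End ℂ (complexBetti A.X 1))) := by
  refine Algebra.adjoin_mono ?_ (pullbackOne_mem_adjoin_of_mem_closure _ hφ)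
  rintro _ ⟨γ, hγ, rfl⟩
  rw [Set.mem_singleton_iff.1 hγ]
  exact Set.mem_singleton _

/-- **`φ ∈ ℤ[ψ]` with `ψ` Rosati-symmetric ⟹ `φ` Rosati-symmetric** (on `H¹`: `Q_h(φ^* v, w) = Q_h(v, φ^* w)`): every
element of the totally real field `E = ℚ(ψ)` is `†`-symmetric. [cite: MoonenZarhin1998WeilClasses, §1 Table 1, Type 1 («E₀ = E» totally real, S_λ ⊇ E; chunk p0002 L60–L84)]
[cite: LangeBirkenhake1992, §5.1 and §5.3] -/
theorem polarizationPairingOne_pullbackOne_symm_of_mem_closure_singleton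
    (hψsym : ∀ v w : complexBetti A.X 1, polarizationPairingOne A.X h (A.dim - 1) (pullbackOne A ψ v) w =
      polarizationPairingOne A.X h (A.dim - 1) v (pullbackOne A ψ w))
    (hφ : End.of φ ∈ Subring.closure {End.of ψ}) (v w : complexBetti A.X 1) :
    polarizationPairingOne A.X h (A.dim - 1) (pullbackOne A φ v) w =
      polarizationPairingOne A.X h (A.dim - 1) v (pullbackOne A φ w) :=
  polarizationPairingOne_symm_of_mem_adjoin_singleton hψsym (pullbackOne_mem_adjoin_singleton_of_mem_closure hφ) v w

/-- **TYPE 1 WITH `m = 1` FROM End-LEVEL DATA — `W_F(A)` IS DECOMPOSABLE FOR `F = ℚ(φ)`, `φ ∈ ℤ[ψ] ⊆ E = ℚ(ψ)`**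
(`ψ` a Rosati-symmetric real multiplication; `P(φ) = 0`, `P` monic irreducible of degree `e`, `e · 2m = 2 dim A`;
`h ∈ B¹ ⊗ ℂ`, `Q_h` non-degenerate): the tree's symmetric case `weilClassesField_le_divisorClassesSpan_of_symm` with its
hypothesis «`φ^*` is `Q_h`-symmetric» discharged from `φ ∈ ℤ[ψ]`. [cite: MoonenZarhin1998WeilClasses, §1 Criterion (2) and its proof, type 1 with m = 1 («F ⊆ B = E»; chunk p0003 L46–L90)]
[cite: Milne1999LefschetzClasses, Thm. 3.2, Cor. 4.5] -/
theorem weilClassesField_le_divisorClassesSpan_of_mem_closure_singleton_of_symm (hA : 0 < A.dim)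
    (hPm : P.Monic) (hPe : P.natDegree = e) (hPirr : Irreducible (P.map (Int.castRingHom ℚ)))
    (hφ : Polynomial.eval₂ (Int.castRingHom (CategoryTheory.End A)) (φ : CategoryTheory.End A) P = 0)
    (her : e * (2 * m) = 2 * A.dim) (hh : h ∈ hodgeClassSpan A.dim A.X 1)
    (hnd : ∀ x : complexBetti A.X 1, (∀ y, polarizationPairingOne A.X h (A.dim - 1) x y = 0) → x = 0)
    (hψsym : ∀ v w : complexBetti A.X 1, polarizationPairingOne A.X h (A.dim - 1) (pullbackOne A ψ v) w =
      polarizationPairingOne A.X h (A.dim - 1) v (pullbackOne A ψ w))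
    (hφe : End.of φ ∈ Subring.closure {End.of ψ}) :
    weilClassesField A φ P (2 * m) ≤ divisorClassesSpan A.X A.dim m :=
  weilClassesField_le_divisorClassesSpan_of_symm hA hPm hPe hPirr hφ her hh hnd
    (polarizationPairingOne_pullbackOne_symm_of_mem_closure_singleton hψsym hφe)

/-- **… and algebraic: THE WEIL CLASSES OF `ℚ(φ)`, `φ ∈ ℤ[ψ]`, `ψ` A ROSATI-SYMMETRIC REAL MULTIPLICATION, ARE
ALGEBRAIC** (Lefschetz `(1,1)`, the tree's `lefschetzOneOne_rational_holds`). [cite: MoonenZarhin1998WeilClasses, Introduction (chunk p0001 L10–L18) and §1 Criterion (2) (chunk p0003 L46–L90)]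
[cite: VoisinHodgeI2002, Thm. 11.30] -/
theorem weilClassesField_le_algebraicClasses_of_mem_closure_singleton_of_symm (hA : 0 < A.dim)
    (hPm : P.Monic) (hPe : P.natDegree = e) (hPirr : Irreducible (P.map (Int.castRingHom ℚ)))
    (hφ : Polynomial.eval₂ (Int.castRingHom (CategoryTheory.End A)) (φ : CategoryTheory.End A) P = 0)
    (her : e * (2 * m) = 2 * A.dim) (hh : h ∈ hodgeClassSpan A.dim A.X 1)
    (hnd : ∀ x : complexBetti A.X 1, (∀ y, polarizationPairingOne A.X h (A.dim - 1) x y = 0) → x = 0)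
    (hψsym : ∀ v w : complexBetti A.X 1, polarizationPairingOne A.X h (A.dim - 1) (pullbackOne A ψ v) w =
      polarizationPairingOne A.X h (A.dim - 1) v (pullbackOne A ψ w))
    (hφe : End.of φ ∈ Subring.closure {End.of ψ}) :
    weilClassesField A φ P (2 * m) ≤ algebraicClasses A.X m :=
  (weilClassesField_le_divisorClassesSpan_of_mem_closure_singleton_of_symm hA hPm hPe hPirr hφ her hh hnd hψsym hφe).trans
    (AbelianVariety.divisorClassesSpan_le_algebraicClasses A
      (fun c hc hc' ↦ lefschetzOneOne_rational_holds (AbelianVariety.isSmoothProjective_holds (A := A)) c hc hc') m)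

end TypeOneSimple

end Literature.AlgebraicGeometry.HodgeTheory

end
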